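import Literature.Analysis.PDE.ParabolicJointSmoothness
import HarnessLib

/-!
# Joint smoothness of classical solutions of nonlinear evolution equations (topic `Analysis/PDE`)

The nonlinear analogue of `ParabolicJointSmoothness.lean`, needed for the limit of the
quasilinear Picard scheme (hypothesis `hQL` of
`Literature.Geometry.Riemannian.ricciFlow_shortTime_existence_of_quasilinear`). Let
`w : ℝ → E' → X` have smooth slices on `[0, T]`, all frame-word derivatives jointly continuous on
`[0, T] × U`, and satisfy word by word on `U` the equation `∂ₜ ∂_β w = ∂_β 𝒩(w)` with
`𝒩(w)(t, x) = Φ₀(x, J² w(t, x))` for a globally smooth function `Φ₀` of the point and the frame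
`2`-jet. Then `w` is jointly `C^∞` on `[0, T] × U`.

The tower: the class of *jet composites* `(t, x) ↦ Φ(x, Jʳ w(t, x))` (`Φ` smooth) is stable under
spatial frame derivatives (`Φ ↦ Φₐ` on `(r+1)`-jets) and — through the equation — under the time
derivative (`Φ ↦ Ψ` on `(r+2)`-jets); an induction on the order of joint differentiability with
the cut-off trick of the linear tower concludes.

* `JetTower.Jet`, `JetTower.jetW` — frame jets; `restrictJ`, `shiftJ`;
* `JetTower.fderiv_comp_jetW` — the spatial chain rule; `JetTower.exists_word_comp`;
* `JetTower.contDiffOn_slab_of_classical` — the theorem.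

Everything is proved; no named fact and no `sorry` is introduced.

## References

* A. Friedman, *Partial Differential Equations of Parabolic Type*, Prentice-Hall 1964, Ch. 3, §5
  (regularity of classical solutions). [Friedman1964]
-/

noncomputable section

open Set Function Filter Topology Metric InnerProductSpace
open scoped ContDiff Topology RealInnerProductSpace

namespace Literature.Analysis.PDE

open Literature.Analysis.FunctionSpaces Literature.Analysis.FluidPDE Literature.Analysis.Calculus

namespace JetTower

variable {E' : Type*} [NormedAddCommGroup E'] [InnerProductSpace ℝ E'] [FiniteDimensional ℝ E']
variable {X : Type*} [NormedAddCommGroup X] [NormedSpace ℝ X]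

/-! ### Frame jets -/

/-- The index set of frame words of length `≤ r`. [folklore] -/
abbrev JIdx (E' : Type*) [NormedAddCommGroup E'] [InnerProductSpace ℝ E'] (r : ℕ) : Type :=
  (j : Fin (r + 1)) × (Fin j → Fin (Module.finrank ℝ E'))

/-- The space of frame `r`-jets with values in `X`. [folklore] -/
abbrev Jet (E' : Type*) [NormedAddCommGroup E'] [InnerProductSpace ℝ E'] (r : ℕ) (X : Type*) : Type _ := JIdx E' r → X

/-- The frame word of an index. [folklore] -/
def wordOf {r : ℕ} (i : JIdx E' r) : List E' := List.ofFn fun k ↦ stdOrthonormalBasis ℝ E' (i.2 k)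

/-- **The frame `r`-jet** of `g` at `x`: all frame-word derivatives of length `≤ r`. [folklore] -/
def jetW (r : ℕ) (g : E' → X) (x : E') : Jet E' r X := fun i ↦ iterDirDeriv (wordOf i) g x

/-- `jetW_apply`: unfolding. [folklore] -/
@[simp] theorem jetW_apply (r : ℕ) (g : E' → X) (x : E') (i : JIdx E' r) : jetW r g x i = iterDirDeriv (wordOf i) g x := by rfl

/-- The embedding of indices of length `≤ r` into indices of length `≤ r + 1`. [folklore] -/
def liftIdx {r : ℕ} (i : JIdx E' r) : JIdx E' (r + 1) := ⟨⟨i.1, by omega⟩, i.2⟩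

/-- The index of the word `a :: word i`. [folklore] -/
def consIdx {r : ℕ} (a : Fin (Module.finrank ℝ E')) (i : JIdx E' r) : JIdx E' (r + 1) := ⟨⟨i.1 + 1, by omega⟩, Fin.cons a i.2⟩

/-- `wordOf_liftIdx`: the word is unchanged. [folklore] -/
@[simp] theorem wordOf_liftIdx {r : ℕ} (i : JIdx E' r) : wordOf (liftIdx i) = wordOf i := rfl

/-- `wordOf_consIdx`: the word gets the new letter in front. [folklore] -/
@[simp] theorem wordOf_consIdx {r : ℕ} (a : Fin (Module.finrank ℝ E')) (i : JIdx E' r) :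
    wordOf (consIdx a i) = stdOrthonormalBasis ℝ E' a :: wordOf i := by
  simp [wordOf, consIdx, List.ofFn_succ]

/-- **Restriction** of `(r+1)`-jets to `r`-jets. [folklore] -/
def restrictJ (r : ℕ) : Jet E' (r + 1) X →L[ℝ] Jet E' r X := ContinuousLinearMap.pi fun i ↦ ContinuousLinearMap.proj (liftIdx i)

/-- **Shift** of `(r+1)`-jets by the letter `a`: `(σₐ J)_w = J_{a :: w}`. [folklore] -/
def shiftJ (r : ℕ) (a : Fin (Module.finrank ℝ E')) : Jet E' (r + 1) X →L[ℝ] Jet E' r X :=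
  ContinuousLinearMap.pi fun i ↦ ContinuousLinearMap.proj (consIdx a i)

omit [FiniteDimensional ℝ E'] in
/-- `restrictJ_apply`: unfolding. [folklore] -/
@[simp] theorem restrictJ_apply (r : ℕ) (J : Jet E' (r + 1) X) (i : JIdx E' r) : restrictJ r J i = J (liftIdx i) := rfl

omit [FiniteDimensional ℝ E'] in
/-- `shiftJ_apply`: unfolding. [folklore] -/
@[simp] theorem shiftJ_apply (r : ℕ) (a : Fin (Module.finrank ℝ E')) (J : Jet E' (r + 1) X) (i : JIdx E' r) : shiftJ r a J i = J (consIdx a i) := rfl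

/-- Restricting the `(r+1)`-jet gives the `r`-jet. [folklore] -/
theorem restrictJ_jetW (r : ℕ) (g : E' → X) (x : E') : restrictJ r (jetW (r + 1) g x) = jetW r g x := by
  funext _; rfl

/-- Shifting the `(r+1)`-jet gives the `r`-jet of the frame derivative (outermost letter). [folklore] -/
theorem shiftJ_jetW (r : ℕ) (a : Fin (Module.finrank ℝ E')) (g : E' → X) (x : E') (i : JIdx E' r) :
    shiftJ r a (jetW (r + 1) g x) i = fderiv ℝ (iterDirDeriv (wordOf i) g) x (stdOrthonormalBasis ℝ E' a) := by
  simp [jetW, iterDirDeriv_cons]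

/-- The jet of a smooth map is smooth in the base point. [folklore] -/
theorem contDiff_jetW (r : ℕ) {g : E' → X} (hg : ContDiff ℝ ∞ g) : ContDiff ℝ ∞ (jetW r g) :=
  contDiff_pi.2 fun _ ↦ contDiff_iterDirDeriv hg _

/-- **The derivative of the jet map**: `D(Jʳ g)(x) v` has components `D(∂_w g)(x) v`. [folklore] -/
theorem hasFDerivAt_jetW (r : ℕ) {g : E' → X} (hg : ContDiff ℝ ∞ g) (x : E') :
    HasFDerivAt (jetW r g) (ContinuousLinearMap.pi fun i ↦ fderiv ℝ (iterDirDeriv (wordOf i) g) x) x := by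
  rw [show jetW r g = fun x i ↦ iterDirDeriv (wordOf i) g x from rfl, hasFDerivAt_pi]
  intro _
  exact (((contDiff_iterDirDeriv hg _).differentiable (by simp)) x).hasFDerivAt

/-! ### Jet composites and the spatial chain rule -/

variable {Y : Type*} [NormedAddCommGroup Y] [NormedSpace ℝ Y]

/-- **The spatial derivative of a jet composite is a jet composite**: for smooth `Φ` on
`E' × Jet r`, the frame derivative `∂ₐ [Φ(x, Jʳ g(x))]` is `Φₐ(x, J^{r+1} g(x))` with
`Φₐ(x, J') = DΦ(x, π J') (eₐ, σₐ J')`. [folklore] -/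
def derivComp (r : ℕ) (Φ : E' × Jet E' r X → Y) (a : Fin (Module.finrank ℝ E')) (q : E' × Jet E' (r + 1) X) : Y :=
  fderiv ℝ Φ (q.1, restrictJ r q.2) (stdOrthonormalBasis ℝ E' a, shiftJ r a q.2)

/-- `derivComp` of a smooth `Φ` is smooth. [folklore] -/
theorem contDiff_derivComp (r : ℕ) {Φ : E' × Jet E' r X → Y} (hΦ : ContDiff ℝ ∞ Φ) (a : Fin (Module.finrank ℝ E')) :
    ContDiff ℝ ∞ (derivComp r Φ a) := by
  have h1 : ContDiff ℝ ∞ fun q : E' × Jet E' (r + 1) X ↦ ((q.1, restrictJ r q.2) : E' × Jet E' r X) :=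
    contDiff_fst.prodMk ((restrictJ (X := X) r).contDiff.comp contDiff_snd)
  have h2 : ContDiff ℝ ∞ fun q : E' × Jet E' (r + 1) X ↦ ((stdOrthonormalBasis ℝ E' a, shiftJ r a q.2) : E' × Jet E' r X) :=
    contDiff_const.prodMk ((shiftJ (X := X) r a).contDiff.comp contDiff_snd)
  exact ((hΦ.fderiv_right (m := ∞) (by norm_cast)).comp h1).clm_apply h2

/-- **The spatial chain rule for jet composites.** [folklore] -/
theorem fderiv_comp_jetW (r : ℕ) {Φ : E' × Jet E' r X → Y} (hΦ : ContDiff ℝ ∞ Φ) {g : E' → X} (hg : ContDiff ℝ ∞ g)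
    (x : E') (a : Fin (Module.finrank ℝ E')) :
    fderiv ℝ (fun y ↦ Φ (y, jetW r g y)) x (stdOrthonormalBasis ℝ E' a) = derivComp r Φ a (x, jetW (r + 1) g x) := by
  have hJ := hasFDerivAt_jetW r hg x
  have hpair : HasFDerivAt (fun y ↦ ((y, jetW r g y) : E' × Jet E' r X))
      ((ContinuousLinearMap.id ℝ E').prod (ContinuousLinearMap.pi fun i ↦ fderiv ℝ (iterDirDeriv (wordOf i) g) x)) x :=
    (hasFDerivAt_id x).prodMk hJ
  have hΦd : HasFDerivAt Φ (fderiv ℝ Φ (x, jetW r g x)) (x, jetW r g x) := ((hΦ.differentiable (by simp)) _).hasFDerivAt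
  have hc : HasFDerivAt (fun y ↦ Φ (y, jetW r g y)) ((fderiv ℝ Φ (x, jetW r g x)).comp
      ((ContinuousLinearMap.id ℝ E').prod (ContinuousLinearMap.pi fun i ↦ fderiv ℝ (iterDirDeriv (wordOf i) g) x))) x := hΦd.comp x hpair
  rw [hc.fderiv, derivComp]
  simp only [ContinuousLinearMap.coe_comp, Function.comp_apply, ContinuousLinearMap.prod_apply, ContinuousLinearMap.coe_id', id_eq,
    ContinuousLinearMap.coe_pi', restrictJ_jetW]
  congr 2
  funext i
  rw [shiftJ_jetW]

/-- **Word derivatives of jet composites are jet composites**: for every frame word `β` and smooth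
`Φ` on `r`-jets there is a smooth `Φ_β` on `(r + |β|)`-jets with
`∂_β [Φ(x, Jʳ g(x))] = Φ_β(x, J^{r+|β|} g(x))` for all smooth `g`. [folklore] -/
theorem exists_word_comp (β : List (Fin (Module.finrank ℝ E'))) :
    ∀ (r : ℕ) {Φ : E' × Jet E' r X → Y}, ContDiff ℝ ∞ Φ →
      ∃ Φ' : E' × Jet E' (r + β.length) X → Y, ContDiff ℝ ∞ Φ' ∧ ∀ {g : E' → X}, ContDiff ℝ ∞ g → ∀ x,
        iterDirDeriv (β.map (stdOrthonormalBasis ℝ E')) (fun y ↦ Φ (y, jetW r g y)) x = Φ' (x, jetW (r + β.length) g x) := by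
  induction β with
  | nil => intro r Φ hΦ; exact ⟨Φ, hΦ, fun _ x ↦ rfl⟩
  | cons a β ih =>
    intro r Φ hΦ
    obtain ⟨Φ', hΦ', hcomp⟩ := ih r hΦ
    refine ⟨derivComp (r + β.length) Φ' a, contDiff_derivComp _ hΦ' a, fun {g} hg x ↦ ?_⟩
    rw [List.map_cons, iterDirDeriv_cons]
    have hfun : iterDirDeriv (β.map (stdOrthonormalBasis ℝ E')) (fun y ↦ Φ (y, jetW r g y)) = fun y ↦ Φ' (y, jetW (r + β.length) g y) :=
      funext fun y ↦ hcomp hg y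
    rw [hfun]
    exact fderiv_comp_jetW _ hΦ' hg x a

/-! ### General restrictions and the word of an index -/

/-- Restriction of `s'`-jets to `s`-jets, `s ≤ s'`. [folklore] -/
def restrictLE {s s' : ℕ} (h : s ≤ s') : Jet E' s' X →L[ℝ] Jet E' s X :=
  ContinuousLinearMap.pi fun i ↦ ContinuousLinearMap.proj (⟨⟨i.1, by omega⟩, i.2⟩ : JIdx E' s')

/-- `restrictLE_jetW`: restricting a jet gives the shorter jet. [folklore] -/
@[simp] theorem restrictLE_jetW {s s' : ℕ} (h : s ≤ s') (g : E' → X) (x : E') : restrictLE h (jetW s' g x) = jetW s g x := rfl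

/-- The word of an index is the frame word of its letters. [folklore] -/
theorem wordOf_eq_map {r : ℕ} (i : JIdx E' r) : wordOf i = (List.ofFn i.2).map (stdOrthonormalBasis ℝ E') := by
  rw [wordOf, List.map_ofFn]; rfl

/-! ### The tower -/

section Tower

variable (T : ℝ) (w : ℝ → E' → X) (U : Set E')

/-- **Jet composites** of `w`: `(t, x) ↦ Φ(x, Jʳ w(t, x))` with `Φ` smooth. [folklore] -/
inductive IsJComp : (ℝ → E' → Y) → Prop
  | comp (r : ℕ) {Φ : E' × Jet E' r X → Y} (hΦ : ContDiff ℝ ∞ Φ) : IsJComp fun t x ↦ Φ (x, jetW r (w t) x)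

/-- **Cut-off jet composites**: finite sums of `χ(x) • G(t, x)` with `G` a jet composite and `χ`
smooth with `tsupport χ ⊆ U`. [folklore] -/
inductive IsJCut : (ℝ → E' → Y) → Prop
  | cut {χ : E' → ℝ} {G : ℝ → E' → Y} (hχ : ContDiff ℝ ∞ χ) (hχU : tsupport χ ⊆ U) (hG : IsJComp w G) : IsJCut fun t x ↦ χ x • G t x
  | zero : IsJCut fun _ _ ↦ 0
  | add {G₁ G₂ : ℝ → E' → Y} : IsJCut G₁ → IsJCut G₂ → IsJCut fun t x ↦ G₁ t x + G₂ t x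

variable {T w U}
variable (hT : 0 < T) (hws : ∀ t ∈ Icc 0 T, ContDiff ℝ ∞ (w t))
  (hwc : ∀ β : List (Fin (Module.finrank ℝ E')), ContinuousOn (fun q : ℝ × E' ↦ iterDirDeriv (β.map (stdOrthonormalBasis ℝ E')) (w q.1) q.2) (Icc 0 T ×ˢ U))
  {Φ₀ : E' × Jet E' 2 X → X} (hΦ₀ : ContDiff ℝ ∞ Φ₀)
  (hwd : ∀ β : List (Fin (Module.finrank ℝ E')), ∀ t ∈ Icc 0 T, ∀ x ∈ U,
    HasDerivWithinAt (fun s ↦ iterDirDeriv (β.map (stdOrthonormalBasis ℝ E')) (w s) x)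
      (iterDirDeriv (β.map (stdOrthonormalBasis ℝ E')) (fun y ↦ Φ₀ (y, jetW 2 (w t) y)) x) (Icc 0 T) t)

include hws in
/-- Jet composites are smooth in space at each time of the slab. [folklore] -/
theorem IsJComp.contDiff_slice {G : ℝ → E' → Y} (hG : IsJComp w G) {t : ℝ} (ht : t ∈ Icc 0 T) : ContDiff ℝ ∞ (G t) := by
  induction hG with
  | comp r hΦ => exact hΦ.comp (contDiff_id.prodMk (contDiff_jetW r (hws t ht)))

include hws in
/-- Cut-off jet composites are smooth in space at each time of the slab. [folklore] -/
theorem IsJCut.contDiff_slice {G : ℝ → E' → Y} (hG : IsJCut w U G) {t : ℝ} (ht : t ∈ Icc 0 T) : ContDiff ℝ ∞ (G t) := by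
  induction hG with
  | cut hχ _ hG => exact hχ.smul (hG.contDiff_slice hws ht)
  | zero => exact contDiff_const
  | add _ _ ih₁ ih₂ => exact ih₁.add ih₂

include hwc in
/-- The jets of `w` are jointly continuous on `[0, T] × U`. [folklore] -/
theorem continuousOn_jetW (r : ℕ) : ContinuousOn (fun q : ℝ × E' ↦ jetW r (w q.1) q.2) (Icc 0 T ×ˢ U) := by
  refine continuousOn_pi.2 fun i ↦ ?_
  have h := hwc (List.ofFn i.2)
  simp only [← wordOf_eq_map] at h
  exact h

include hwc in
/-- Jet composites are jointly continuous on `[0, T] × U`. [folklore] -/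
theorem IsJComp.continuousOn {G : ℝ → E' → Y} (hG : IsJComp w G) : ContinuousOn (uncurry G) (Icc 0 T ×ˢ U) := by
  induction hG with
  | comp r hΦ => exact hΦ.continuous.comp_continuousOn (continuousOn_snd.prodMk (continuousOn_jetW hwc r))

include hwc in
/-- Cut-off jet composites are jointly continuous on the whole slab. [folklore] -/
theorem IsJCut.continuousOn (hU : IsOpen U) {G : ℝ → E' → Y} (hG : IsJCut w U G) : ContinuousOn (uncurry G) (Icc 0 T ×ˢ univ) := by
  induction hG with
  | @cut χ G hχ hχU hG =>
    rintro ⟨t, x⟩ hq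
    have ht : t ∈ Icc 0 T := (mem_prod.1 hq).1
    by_cases hx : x ∈ U
    · -- product of continuous functions, `U` a neighbourhood
      have h1 : ContinuousWithinAt (uncurry G) (Icc 0 T ×ˢ U) (t, x) := hG.continuousOn hwc (t, x) (mk_mem_prod ht hx)
      have h2 : ContinuousWithinAt (uncurry G) (Icc 0 T ×ˢ univ) (t, x) := h1.mono_of_mem_nhdsWithin (by
        refine mem_nhdsWithin.2 ⟨univ ×ˢ U, isOpen_univ.prod hU, mk_mem_prod (mem_univ _) hx, ?_⟩
        rintro ⟨s, y⟩ ⟨h1, h2⟩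
        exact mk_mem_prod (mem_prod.1 h2).1 (mem_prod.1 h1).2)
      have hχc : ContinuousWithinAt (fun q : ℝ × E' ↦ χ q.2) (Icc 0 T ×ˢ univ) (t, x) := (hχ.continuous.comp continuous_snd).continuousWithinAt
      exact hχc.smul h2
    · -- `χ` vanishes near `x`
      have hx' : x ∉ tsupport χ := fun h ↦ hx (hχU h)
      have hev : (fun q : ℝ × E' ↦ χ q.2 • G q.1 q.2) =ᶠ[𝓝 (t, x)] fun _ ↦ 0 := by
        have hc : (χ : E' → ℝ) =ᶠ[𝓝 x] fun _ ↦ 0 := notMem_tsupport_iff_eventuallyEq.1 hx'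
        have hc2 : (fun q : ℝ × E' ↦ χ q.2) =ᶠ[𝓝 (t, x)] fun _ ↦ 0 := (continuous_snd.continuousAt (x := (t, x))).eventually hc
        filter_upwards [hc2] with q hq
        simp [hq]
      exact (continuousAt_const.congr (f := fun _ ↦ (0 : Y)) hev.symm).continuousWithinAt
  | zero => exact continuousOn_const
  | add _ _ ih₁ ih₂ => exact ih₁.add ih₂

include hws in
/-- **Frame derivatives of cut-off jet composites are cut-off jet composites.** [folklore] -/
theorem IsJCut.fderiv_slice {G : ℝ → E' → Y} (hG : IsJCut w U G) (a : Fin (Module.finrank ℝ E')) :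
    ∃ G' : ℝ → E' → Y, IsJCut w U G' ∧ ∀ t ∈ Icc 0 T, ∀ x, fderiv ℝ (G t) x (stdOrthonormalBasis ℝ E' a) = G' t x := by
  induction hG with
  | @cut χ G hχ hχU hG =>
    obtain ⟨r, Φ, hΦ, rfl⟩ : ∃ (r : ℕ) (Φ : E' × Jet E' r X → Y), ContDiff ℝ ∞ Φ ∧ G = fun t x ↦ Φ (x, jetW r (w t) x) := by
      rcases hG with ⟨r, hΦ⟩
      exact ⟨r, _, hΦ, rfl⟩
    refine ⟨fun t x ↦ fderiv ℝ χ x (stdOrthonormalBasis ℝ E' a) • Φ (x, jetW r (w t) x) + χ x • derivComp r Φ a (x, jetW (r + 1) (w t) x),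
      IsJCut.add (IsJCut.cut ((hχ.fderiv_right (m := ∞) (by norm_cast)).clm_apply contDiff_const)
        ((tsupport_fderiv_apply_subset ℝ _).trans hχU) (IsJComp.comp r hΦ))
        (IsJCut.cut hχ hχU (IsJComp.comp (r + 1) (contDiff_derivComp r hΦ a))), fun t ht x ↦ ?_⟩
    have hcomp : ContDiff ℝ ∞ fun y ↦ Φ (y, jetW r (w t) y) := hΦ.comp (contDiff_id.prodMk (contDiff_jetW r (hws t ht)))
    rw [fderiv_fun_smul ((hχ.differentiable (by simp)) x) ((hcomp.differentiable (by simp)) x)]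
    rw [_root_.add_apply, _root_.smul_apply, ContinuousLinearMap.smulRight_apply, fderiv_comp_jetW r hΦ (hws t ht) x a, add_comm]
  | zero => exact ⟨fun _ _ ↦ 0, IsJCut.zero, fun t _ x ↦ by simp⟩
  | add h₁ h₂ ih₁ ih₂ =>
    obtain ⟨G₁', h₁', e₁⟩ := ih₁
    obtain ⟨G₂', h₂', e₂⟩ := ih₂
    refine ⟨fun t x ↦ G₁' t x + G₂' t x, IsJCut.add h₁' h₂', fun t ht x ↦ ?_⟩
    have hd₁ : DifferentiableAt ℝ (_ : E' → Y) x := ((h₁.contDiff_slice hws ht).differentiable (by simp)) x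
    have hd₂ : DifferentiableAt ℝ (_ : E' → Y) x := ((h₂.contDiff_slice hws ht).differentiable (by simp)) x
    rw [fderiv_fun_add hd₁ hd₂, _root_.add_apply, e₁ t ht x, e₂ t ht x]

include hΦ₀ hwd in
/-- **The time derivative of the jets through the equation**: `∂ₜ Jʳ w(t, x) = Λ(x, J^{r+2} w(t, x))`
within `[0, T]` at the points of `U`, for a smooth `Λ`. [folklore] -/
theorem exists_hasDerivWithinAt_jetW (r : ℕ) :
    ∃ Λ : E' × Jet E' (r + 2) X → Jet E' r X, ContDiff ℝ ∞ Λ ∧ ∀ t ∈ Icc 0 T, ∀ x ∈ U, ∀ {g : E' → X}, g = w t → ContDiff ℝ ∞ g →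
      HasDerivWithinAt (fun s ↦ jetW r (w s) x) (Λ (x, jetW (r + 2) g x)) (Icc 0 T) t := by
  -- componentwise: `∂ₜ ∂_{word i} w = ∂_{word i} 𝒩(w) = Φ'_i (x, J^{2 + |i|} w)`
  have hcomp := fun i : JIdx E' r ↦ exists_word_comp (X := X) (Y := X) (List.ofFn i.2) 2 hΦ₀
  choose Φ' hΦ's hΦ' using hcomp
  have hle : ∀ i : JIdx E' r, 2 + (List.ofFn i.2).length ≤ r + 2 := fun i ↦ by simp; omega
  refine ⟨fun q i ↦ Φ' i (q.1, restrictLE (hle i) q.2), contDiff_pi.2 fun i ↦ (hΦ's i).comp (contDiff_fst.prodMk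
    ((restrictLE (X := X) (E' := E') (hle i)).contDiff.comp contDiff_snd)), fun t ht x hx g hg hgs ↦ ?_⟩
  rw [show (fun s ↦ jetW r (w s) x) = fun s i ↦ iterDirDeriv (wordOf i) (w s) x from rfl, hasDerivWithinAt_pi]
  intro i
  have h := hwd (List.ofFn i.2) t ht x hx
  rw [← wordOf_eq_map] at h
  convert h using 1
  simp only [restrictLE_jetW]
  rw [hg, wordOf_eq_map, hΦ' i (hg ▸ hgs) x]

include hws hΦ₀ hwd in
/-- **Time derivatives of cut-off jet composites are cut-off jet composites.** [folklore] -/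
theorem IsJCut.hasDerivWithinAt {G : ℝ → E' → Y} (hG : IsJCut w U G) :
    ∃ Gt : ℝ → E' → Y, IsJCut w U Gt ∧ ∀ t ∈ Icc 0 T, ∀ x, HasDerivWithinAt (fun s ↦ G s x) (Gt t x) (Icc 0 T) t := by
  induction hG with
  | @cut χ G hχ hχU hG =>
    obtain ⟨r, Φ, hΦ, rfl⟩ : ∃ (r : ℕ) (Φ : E' × Jet E' r X → Y), ContDiff ℝ ∞ Φ ∧ G = fun t x ↦ Φ (x, jetW r (w t) x) := by
      rcases hG with ⟨r, hΦ⟩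
      exact ⟨r, _, hΦ, rfl⟩
    obtain ⟨Λ, hΛ, hΛd⟩ := exists_hasDerivWithinAt_jetW hΦ₀ hwd r
    -- the time composite
    have hr2 : r ≤ r + 2 := by omega
    set Ψ : E' × Jet E' (r + 2) X → Y := fun q ↦ fderiv ℝ Φ (q.1, restrictLE hr2 q.2) (0, Λ q) with hΨ
    have hΨs : ContDiff ℝ ∞ Ψ := by
      have h1 : ContDiff ℝ ∞ fun q : E' × Jet E' (r + 2) X ↦ ((q.1, restrictLE hr2 q.2) : E' × Jet E' r X) :=
        contDiff_fst.prodMk ((restrictLE (X := X) (E' := E') hr2).contDiff.comp contDiff_snd)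
      have h2 : ContDiff ℝ ∞ fun q : E' × Jet E' (r + 2) X ↦ (((0 : E'), Λ q) : E' × Jet E' r X) := contDiff_const.prodMk hΛ
      exact ((hΦ.fderiv_right (m := ∞) (by norm_cast)).comp h1).clm_apply h2
    refine ⟨fun t x ↦ χ x • Ψ (x, jetW (r + 2) (w t) x), IsJCut.cut hχ hχU (IsJComp.comp (r + 2) hΨs), fun t ht x ↦ ?_⟩
    by_cases hx : x ∈ U
    · have hJ := hΛd t ht x hx rfl (hws t ht)
      have hpair : HasDerivWithinAt (fun s ↦ ((x, jetW r (w s) x) : E' × Jet E' r X)) ((0 : E'), Λ (x, jetW (r + 2) (w t) x)) (Icc 0 T) t :=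
        (hasDerivWithinAt_const _ _ _).prodMk hJ
      have hΦd : HasFDerivAt Φ (fderiv ℝ Φ (x, jetW r (w t) x)) (x, jetW r (w t) x) := ((hΦ.differentiable (by simp)) _).hasFDerivAt
      have hc := hΦd.comp_hasDerivWithinAt t hpair
      have hval : fderiv ℝ Φ (x, jetW r (w t) x) ((0 : E'), Λ (x, jetW (r + 2) (w t) x)) = Ψ (x, jetW (r + 2) (w t) x) := by
        simp only [hΨ, restrictLE_jetW]
      rw [hval] at hc
      exact hc.const_smul (χ x)
    · have hx' : x ∉ tsupport χ := fun h ↦ hx (hχU h)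
      have h0 : χ x = 0 := image_eq_zero_of_notMem_tsupport hx'
      simp only [h0, zero_smul]
      exact hasDerivWithinAt_const _ _ _
  | zero => exact ⟨fun _ _ ↦ 0, IsJCut.zero, fun t _ x ↦ hasDerivWithinAt_const _ _ _⟩
  | add _ _ ih₁ ih₂ =>
    obtain ⟨G₁', h₁', e₁⟩ := ih₁
    obtain ⟨G₂', h₂', e₂⟩ := ih₂
    exact ⟨fun t x ↦ G₁' t x + G₂' t x, IsJCut.add h₁' h₂', fun t ht x ↦ (e₁ t ht x).add (e₂ t ht x)⟩

include hT hws hwc hΦ₀ hwd in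
/-- **Every cut-off jet composite is jointly `Cⁿ` within the slab**, by induction on `n`. [folklore] -/
theorem IsJCut.contDiffOn_nat (hU : IsOpen U) (n : ℕ) {G : ℝ → E' → Y} (hG : IsJCut w U G) :
    ContDiffOn ℝ n (uncurry G) (Icc 0 T ×ˢ univ) := by
  induction n generalizing G with
  | zero => exact_mod_cast contDiffOn_zero.2 (hG.continuousOn hwc hU)
  | succ n ih =>
    obtain ⟨Gt, hGt, hdt⟩ := hG.hasDerivWithinAt hws hΦ₀ hwd
    choose Gx hGx hdx using fun a ↦ hG.fderiv_slice hws a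
    set f₁ : ℝ × E' → ℝ →L[ℝ] Y := fun p ↦ (1 : ℝ →L[ℝ] ℝ).smulRight (Gt p.1 p.2) with hf₁
    set f₂ : ℝ × E' → E' →L[ℝ] Y := fun p ↦ ∑ a, (innerSL ℝ (stdOrthonormalBasis ℝ E' a)).smulRight (Gx a p.1 p.2) with hf₂
    have h₁ : ∀ p ∈ Icc 0 T ×ˢ (univ : Set E'), HasFDerivWithinAt (fun a ↦ uncurry G (a, p.2)) (f₁ p) (Icc 0 T) p.1 :=
      fun p hp ↦ (hdt p.1 (mem_prod.1 hp).1 p.2).hasFDerivWithinAt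
    have h₂ : ∀ p ∈ Icc 0 T ×ˢ (univ : Set E'), HasFDerivAt (fun b ↦ uncurry G (p.1, b)) (f₂ p) p.2 := by
      intro p hp
      have ht : p.1 ∈ Icc 0 T := (mem_prod.1 hp).1
      have hd : DifferentiableAt ℝ (G p.1) p.2 := ((hG.contDiff_slice hws ht).differentiable (by simp)) p.2
      have heq : fderiv ℝ (G p.1) p.2 = f₂ p := by
        rw [ParabolicTower.fderiv_eq_sum_smulRight, hf₂]
        exact Finset.sum_congr rfl fun a _ ↦ by rw [hdx a p.1 ht p.2]
      exact heq ▸ hd.hasFDerivAt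
    have hc₁ : ContDiffOn ℝ n f₁ (Icc 0 T ×ˢ univ) := ContDiffOn.smulRight contDiffOn_const (ih hGt)
    have hc₂ : ContDiffOn ℝ n f₂ (Icc 0 T ×ˢ univ) := ContDiffOn.sum fun a _ ↦ ContDiffOn.smulRight contDiffOn_const (ih (hGx a))
    exact contDiffOn_succ_of_partial_within (f := uncurry G) (convex_Icc 0 T) (uniqueDiffOn_Icc hT) h₁ h₂ hc₁ hc₂

end Tower

/-! ### The theorem -/

section Main

variable {T : ℝ} {w : ℝ → E' → X} {U : Set E'}
variable (hT : 0 < T) (hws : ∀ t ∈ Icc 0 T, ContDiff ℝ ∞ (w t))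
  (hwc : ∀ β : List (Fin (Module.finrank ℝ E')), ContinuousOn (fun q : ℝ × E' ↦ iterDirDeriv (β.map (stdOrthonormalBasis ℝ E')) (w q.1) q.2) (Icc 0 T ×ˢ U))
  {Φ₀ : E' × Jet E' 2 X → X} (hΦ₀ : ContDiff ℝ ∞ Φ₀)
  (hwd : ∀ β : List (Fin (Module.finrank ℝ E')), ∀ t ∈ Icc 0 T, ∀ x ∈ U,
    HasDerivWithinAt (fun s ↦ iterDirDeriv (β.map (stdOrthonormalBasis ℝ E')) (w s) x)
      (iterDirDeriv (β.map (stdOrthonormalBasis ℝ E')) (fun y ↦ Φ₀ (y, jetW 2 (w t) y)) x) (Icc 0 T) t)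

include hT hws hwc hΦ₀ hwd in
/-- **Joint smoothness of cut-off solutions up to the initial time.** [cite: Friedman1964, Ch. 3, §5] -/
theorem contDiffOn_slab_cut_smul (hU : IsOpen U) {χ : E' → ℝ} (hχ : ContDiff ℝ ∞ χ) (hχU : tsupport χ ⊆ U) :
    ContDiffOn ℝ ∞ (uncurry fun t x ↦ χ x • w t x) (Icc 0 T ×ˢ univ) := by
  -- `w` is the jet composite of the empty word
  set Φe : E' × Jet E' 0 X → X := fun q ↦ q.2 ⟨0, Fin.elim0⟩ with hΦe
  have hΦes : ContDiff ℝ ∞ Φe := (ContinuousLinearMap.proj (R := ℝ) (φ := fun _ : JIdx E' 0 ↦ X) (⟨0, Fin.elim0⟩ : JIdx E' 0)).contDiff.comp contDiff_snd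
  have hbase : IsJCut (Y := X) w U fun t x ↦ χ x • Φe (x, jetW 0 (w t) x) := IsJCut.cut hχ hχU (IsJComp.comp 0 hΦes)
  have heq : (uncurry fun t x ↦ χ x • w t x) = uncurry fun t x ↦ χ x • Φe (x, jetW 0 (w t) x) := by
    funext p; simp [hΦe, jetW, wordOf]
  rw [heq, contDiffOn_infty]
  intro n
  exact hbase.contDiffOn_nat hT hws hwc hΦ₀ hwd hU n

include hT hws hwc hΦ₀ hwd in
/-- **Joint smoothness of classical solutions of nonlinear evolution equations up to the initial
time** (`U` open): `w` is `C^∞` on `[0, T] × U` within. [cite: Friedman1964, Ch. 3, §5] -/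
theorem contDiffOn_slab_of_classical (hU : IsOpen U) : ContDiffOn ℝ ∞ (uncurry w) (Icc 0 T ×ˢ U) := by
  rintro ⟨t, x⟩ hp
  have ht : t ∈ Icc 0 T := (mem_prod.1 hp).1
  have hx : x ∈ U := (mem_prod.1 hp).2
  obtain ⟨ε, hε, hball⟩ := Metric.isOpen_iff.1 hU x hx
  let b : ContDiffBump x := ⟨ε / 4, ε / 2, by linarith, by linarith⟩
  have hbU : tsupport (b : E' → ℝ) ⊆ U := by
    rw [b.tsupport_eq]; exact (closedBall_subset_ball (by show ε / 2 < ε; linarith)).trans hball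
  have hsm := contDiffOn_slab_cut_smul hT hws hwc hΦ₀ hwd hU b.contDiff hbU
  have h1 : ContDiffWithinAt ℝ ∞ (uncurry fun t x ↦ (b : E' → ℝ) x • w t x) (Icc 0 T ×ˢ univ) (t, x) :=
    hsm (t, x) (mk_mem_prod ht (mem_univ _))
  have hev : (uncurry w) =ᶠ[𝓝[Icc 0 T ×ˢ univ] (t, x)] uncurry fun t x ↦ (b : E' → ℝ) x • w t x := by
    have hO : IsOpen (univ ×ˢ ball x (ε / 4) : Set (ℝ × E')) := isOpen_univ.prod isOpen_ball
    have hmem : (t, x) ∈ (univ ×ˢ ball x (ε / 4) : Set (ℝ × E')) := mk_mem_prod (mem_univ _) (mem_ball_self (by linarith))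
    filter_upwards [mem_nhdsWithin_of_mem_nhds (hO.mem_nhds hmem)] with q hq
    have hq2 : q.2 ∈ closedBall x (ε / 4) := ball_subset_closedBall (mem_prod.1 hq).2
    simp only [uncurry]
    rw [b.one_of_mem_closedBall hq2, one_smul]
  have h2 : ContDiffWithinAt ℝ ∞ (uncurry w) (Icc 0 T ×ˢ univ) (t, x) :=
    h1.congr_of_eventuallyEq hev (by
      show w t x = (b : E' → ℝ) x • w t x
      rw [b.one_of_mem_closedBall (mem_closedBall_self (by positivity)), one_smul])
  exact h2.mono (prod_mono le_rfl (subset_univ _))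

end Main

end JetTower

end Literature.Analysis.PDE
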